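import Literature.MathematicalPhysics.QuantumFieldTheory.Balaban1983to89.B9Thm37WholeDir

/-!
# `Balaban1983to89.B9Thm37GlueDir` — Theorem 3.7's Glue faces and the whole leaf OVER THE DIRECTION LETTERS (`Identities₂`, ruling R1′):
# the LEFT face with the (3.88) derivative and the Leibniz derivative as TWO letters, the RIGHT face with the transposed (3.88) summed over the
# directions, ★★ `conv342_of_local342₂`, ★★ `thm37Printed_of_local342₂` — same constants and located numerics as v1

T. Bałaban, *Propagators for lattice gauge theories in a background field*, Commun. Math. Phys. **99** (1985) 389–434
[`Balaban1985BackgroundPropagators`, "B9"], Thm 3.7 (3.87)–(3.90) pp. 408–410, Cor. 3.6 p. 408, (3.42) p. 397; T. Bałaban, *Propagators and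
renormalization transformations for lattice gauge theories. II*, Commun. Math. Phys. **96** (1984) 223–250 [`Balaban1984PropagatorsII`, "[4]"], Prop. 2.2
(2.64)–(2.67) p. 234, (2.39)–(2.44) pp. 229–230, (2.51)–(2.55) p. 232, Lemma 2.1 (2.60)–(2.61) p. 234.

statement-level skeleton of published theorems with citation tags; proofs where landed; nothing here is a claim about the
Yang–Mills mass gap

WHY THIS FILE (cell `pub-ymgap`, Track A node N06 [B9], rows 18–19 of the certificate — the `Identities` conjunct of `h36`; node00-def-Y g20 OBS-2, dag-n06-d
g10 ruling R1′, def-Y memo `IDENTITIES2-DRAFT.md` §2; seat `pub-ymgap-dag-n06-c` g10, the `B9Thm37Whole` lineage, 2026-08-28).  `B9Thm37WholeDir` (p610045) states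
Theorem 3.7's algebraic schema over the direction letters (`Identities₂`: `K(h_□) = Σ_μ P_{□,μ}∇_{U,μ} + C_□`) and shows that, through the STACKING device
(`stackDir`∕`costackDir`), the LEFT Glue inputs `h388`, `hLeib` (E = Δ_U), `hP`, `hPL` take literally their v1 shapes at the two-space letter `Y′ := X × Dir`.
Two of n06-k's four Glue faces (`B9Thm37Glue`) then INSTANTIATE (entry 1; entry 4); the other two need the finite-family edits of this file:
* §1 ★ `thm37_leftEntry_of_342_twoD` — `thm37_leftEntry_of_342` with the derivative letter SPLIT into the (3.88)∕R′ letter `D₁ : X → Y₁` (with `P : Y₁ → X`,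
  `h342_2₁`, `h388`) and the Leibniz∕entry letter `D₂ : X → Y₂` (with `PL : Y₂ → Z`, `h342_2₂`, `hLeib`): the v1 proof verbatim — `leftEntry_cube_majorant` reads
  only `D₂`, `h389_of_342` and the fixed point only `D₁` (memo §2 (a): a parameter split, the two uses are independent).  Entry 2 of (3.42) (E = ∇_U slice-wise)
  takes `D₁ := stackDir (𝔡.Dd U)`, `D₂ := 𝔬.D U`.
* §2 ★ `rightR_cube_majorant_dir`, ★ `thm37_rightEntry_of_342_dir` — the RIGHT face with the transposed (3.88) `G′₀Δ′_a = I − Σ_□ h_□G′_□(Σ_μ ∇*_{U,μ}Pᵗ_{□,μ} + Cᵗ_□)`: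
  per-direction entry 3 of the cube operators and per-direction COLUMN kernels `KPd μ` summing below `KPt`; the direction sum is taken at the kernel level
  (`hom_majorant_comp_localRight` per μ, then `Σ_μ Σ_{y″} KPd μ ≤ Σ_{y″} KPt`), so the final majorant, the smallness and the constants are those of v1 — NO
  factor `#Dir` (memo §2 «finite-family edit»).  The E-role `∇*_U` (slice-wise, `hLeibT`) is unchanged.
* §3 ★★ `conv342_of_local342₂` — Theorem 3.7 at one member and one U for the four entries of (3.42) from `StaticOK`, `Local342`, `DirSupSq37`, `Identities₂`, [4] Lemma
  2.1 and the located smallness — the SAME constant `const37` and smallness `hq ∕ hq′` as v1; ★★ `thm37Printed_of_local342₂` — the whole printed leaf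
  `B9.Thm37Printed c35 geo bg (E37OfOps …)`.
OWNERSHIP.  The engine's OTHER consumers of `Identities` (n06-k's `B9RWSums*`, `B9Cor38Whole`, `B9Thm312Whole` …) thread `Identities₂` the same way (stacked
inputs where the (3.88) derivative is an independent letter, §1-type splits where it is shared) — the engine owner's; the instance (`𝔩`, `DirSupSq37` at the
pins) is node00-def-Y's FILE C-2 ∕ dag-n06-d's edition.  Nothing landed is edited.

HONEST SCOPE.  Finite-dimensional majorant bookkeeping over n06-k's landed Glue lemmas and [4] Lemma 2.1 as a hypothesis; Corollary 3.6, (3.88) and the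
Leibniz rules are HYPOTHESES (schemas), nothing of [B9] is asserted; COUNT-NEUTRAL; N06 NOT discharged; one finite lattice programme — nothing continuum,
nothing about OS positivity or the mass gap.
-/

namespace Literature.MathematicalPhysics.QuantumFieldTheory.Balaban1983to89.B9Thm37GlueDir

open Finset B6RandomWalk B6RandomWalkHom B9Thm37Sum B9Thm34Ext B9Thm37Glue B9Thm37GlueCor36 B9Thm37Whole B9Thm37WholeDir
  B9RWSums346SecondDiffGp

noncomputable section

variable {g : B9.Geometry} [Fintype g.Site] [DecidableEq g.Site]

/-! ## §1 The LEFT face with the (3.88) derivative and the Leibniz derivative as two letters -/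

section LeftTwoD

variable {R : ℝ} {H : Prop} {X Y₁ Y₂ Z : Type}

/-- ★ **THEOREM 3.7 ⇒ THE E-ENTRY OF (3.42) FOR G′, THE (3.88) DERIVATIVE AND THE LEIBNIZ DERIVATIVE BEING TWO LETTERS** (`B9Thm37Glue.thm37_leftEntry_of_342`
with `D` split into `D₁` — in `K(h_□) = P_□D₁ + C_□`, `h388`, `hP`, `h342_2₁` — and `D₂` — in the Leibniz rule `E M_{h_□} = M_{h^Z_□}E + (PL_□D₂ + CL_□)`, `hPL`,
`h342_2₂`): same inputs otherwise, same conclusion `EG′ ≪ B₀(N + N′e^{δ₀ρ}(κ₃ + κ₄))c₁(α)(1 − N′θc₁(α))⁻¹W(y)e^{−(1−α)δ₀d(y,y′)}`; the proof is n06-k's verbatim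
(the cube term reads only `D₂`, the R′-majorant (3.89) and the fixed point only `D₁`).  Used at `D₁ := stackDir (∇_{U,·})` (the direction letters, (3.88) over
`Σ_μ P_μ∇_μ`) and `D₂ :=` the slice-diagonal ∇_U of the entry readings.
[cite: Balaban1985BackgroundPropagators, Thm 3.7 (3.87)–(3.90) pp.409–410, (3.42) p.397; Balaban1984PropagatorsII, Prop 2.2 (2.64)–(2.67) p.234] -/
theorem thm37_leftEntry_of_342_twoD [Fintype X] [DecidableEq X] [Fintype Z] [DecidableEq Z]
    (blk : X → g.Site) (blkY₁ : Y₁ → g.Site) (blkY₂ : Y₂ → g.Site) (blkZ : Z → g.Site) (d : ℕ)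
    (δ₀ α ρ B₀ κ₁ κ₂ κ₃ κ₄ N N' : ℝ) (W : g.Site → ℝ) {ι : Type} [Fintype ι] (S S' : ι → Finset g.Site)
    (h : ι → X → ℝ) (hZ : ι → Z → ℝ) (KP KC KP' KC' : ι → g.Site → g.Site → ℝ) {G' Δ : Module.End ℝ (X → ℝ)}
    (hB₀ : 0 ≤ B₀) (hδ₀ : 0 ≤ δ₀) (hκ : 0 ≤ κ₁ + κ₂) (hκ' : 0 ≤ κ₃ + κ₄) (hN : 0 ≤ N) (hN' : 0 ≤ N')
    (hW : ∀ y, 0 ≤ W y) (hαδ : 0 ≤ (1 - α) * δ₀)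
    (htri : Triangle254 (toB6 g R H)) (hrefl : ∀ y : g.Site, g.dist y y = 0)
    (hdnn : ∀ y y' : g.Site, 0 ≤ g.dist y y') (hlen : ∀ y : g.Site, 0 ≤ g.len y)
    (h261 : Ineq261 d (toB6 g R H) δ₀ α) (h263 : Ineq263 d (toB6 g R H) δ₀ α)
    (hsmall : N' * (B₀ * Real.exp (δ₀ * ρ) * (κ₁ + κ₂)) * B6.c1 d δ₀ α < 1)
    (hh : ∀ i x, |h i x| ≤ 1) (hhZ : ∀ i v, |hZ i v| ≤ 1) (hSZ : ∀ i v, hZ i v ≠ 0 → blkZ v ∈ S i)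
    (hcnt : ∀ a : g.Site, (∑ i, if a ∈ S i then (1 : ℝ) else 0) ≤ N)
    (hcnt' : ∀ a : g.Site, (∑ i, if a ∈ S' i then (1 : ℝ) else 0) ≤ N')
    (hKP : ∀ i a b, 0 ≤ KP i a b) (hlocP : ∀ i a y'', KP i a y'' ≠ 0 → g.dist a y'' ≤ ρ)
    (hrowP : ∀ i (a : g.Site), ∑ y'' : g.Site, KP i a y'' * g.len y'' ≤ if a ∈ S' i then κ₁ else 0)
    (hKC : ∀ i a b, 0 ≤ KC i a b) (hlocC : ∀ i a y'', KC i a y'' ≠ 0 → g.dist a y'' ≤ ρ)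
    (hrowC : ∀ i (a : g.Site), ∑ y'' : g.Site, KC i a y'' * g.len y'' ^ 2 ≤ if a ∈ S' i then κ₂ else 0)
    (hKP' : ∀ i a b, 0 ≤ KP' i a b) (hlocP' : ∀ i a y'', KP' i a y'' ≠ 0 → g.dist a y'' ≤ ρ)
    (hrowP' : ∀ i (a : g.Site), ∑ y'' : g.Site, KP' i a y'' * g.len y'' ≤ if a ∈ S' i then κ₃ * W a else 0)
    (hKC' : ∀ i a b, 0 ≤ KC' i a b) (hlocC' : ∀ i a y'', KC' i a y'' ≠ 0 → g.dist a y'' ≤ ρ)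
    (hrowC' : ∀ i (a : g.Site), ∑ y'' : g.Site, KC' i a y'' * g.len y'' ^ 2 ≤ if a ∈ S' i then κ₄ * W a else 0)
    {Gsq Cop : ι → Module.End ℝ (X → ℝ)} {D₁ : (X → ℝ) →ₗ[ℝ] (Y₁ → ℝ)} {P : ι → (Y₁ → ℝ) →ₗ[ℝ] (X → ℝ)}
    {D₂ : (X → ℝ) →ₗ[ℝ] (Y₂ → ℝ)} {E : (X → ℝ) →ₗ[ℝ] (Z → ℝ)} {PL : ι → (Y₂ → ℝ) →ₗ[ℝ] (Z → ℝ)} {CL : ι → (X → ℝ) →ₗ[ℝ] (Z → ℝ)}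
    (h342_1 : ∀ i, HasMajorant (g := toB6 g R H) blk (Gsq i)
      (fun a b => B₀ * g.len a ^ 2 * Real.exp (-(δ₀ * g.dist a b))))
    (h342_2₁ : ∀ i, HasMajorantHom (g := toB6 g R H) blk blkY₁ (D₁ ∘ₗ Gsq i)
      (fun a b => B₀ * g.len a * Real.exp (-(δ₀ * g.dist a b))))
    (h342_2₂ : ∀ i, HasMajorantHom (g := toB6 g R H) blk blkY₂ (D₂ ∘ₗ Gsq i)
      (fun a b => B₀ * g.len a * Real.exp (-(δ₀ * g.dist a b))))
    (h342_E : ∀ i, HasMajorantHom (g := toB6 g R H) blk blkZ (E ∘ₗ Gsq i)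
      (fun a b => B₀ * W a * Real.exp (-(δ₀ * g.dist a b))))
    (hP : ∀ i, HasMajorantHom (g := toB6 g R H) blkY₁ blk (P i) (KP i))
    (hC : ∀ i, HasMajorant (g := toB6 g R H) blk (Cop i) (KC i))
    (hPL : ∀ i, HasMajorantHom (g := toB6 g R H) blkY₂ blkZ (PL i) (KP' i))
    (hCL : ∀ i, HasMajorantHom (g := toB6 g R H) blk blkZ (CL i) (KC' i))
    (hLeib : ∀ i, E ∘ₗ mulOp (h i) = mulOp (hZ i) ∘ₗ E + (PL i ∘ₗ D₂ + CL i))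
    (hinv : G' * Δ = 1)
    (h388 : Δ * (∑ i, mulOp (h i) * Gsq i * mulOp (h i)) = 1 - ∑ i, (P i ∘ₗ D₁ + Cop i) * Gsq i * mulOp (h i)) :
    HasMajorantHom (g := toB6 g R H) blk blkZ (E ∘ₗ G')
      (fun (a b : g.Site) => B₀ * (N + N' * Real.exp (δ₀ * ρ) * (κ₃ + κ₄)) * B6.c1 d δ₀ α *
        (1 - N' * (B₀ * Real.exp (δ₀ * ρ) * (κ₁ + κ₂)) * B6.c1 d δ₀ α)⁻¹ * W a *
        Real.exp (-((1 - α) * δ₀ * g.dist a b))) := by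
  have hθ : 0 ≤ B₀ * Real.exp (δ₀ * ρ) * (κ₁ + κ₂) := mul_nonneg (mul_nonneg hB₀ (Real.exp_nonneg _)) hκ
  have hA : 0 ≤ B₀ * (N + N' * Real.exp (δ₀ * ρ) * (κ₃ + κ₄)) :=
    mul_nonneg hB₀ (add_nonneg hN (mul_nonneg (mul_nonneg hN' (Real.exp_nonneg _)) hκ'))
  -- EG′₀ = Σ_□ E(h_□G′_□h_□): a finite sum of localized two-space operators ((3.87) with E applied)
  have hcube : ∀ i, HasMajorantHom (g := toB6 g R H) blk blkZ (E ∘ₗ (mulOp (h i) * Gsq i * mulOp (h i)))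
      (fun (a b : g.Site) => ((if a ∈ S i then (1 : ℝ) else 0) * (B₀ * W a) +
        (if a ∈ S' i then (1 : ℝ) else 0) * (B₀ * Real.exp (δ₀ * ρ) * (κ₃ + κ₄) * W a)) *
        Real.exp (-(δ₀ * g.dist a b))) := fun i =>
    leftEntry_cube_majorant blk blkY₂ blkZ δ₀ ρ B₀ κ₃ κ₄ W (S i) (S' i) (h i) (hZ i) (KP' i) (KC' i) hB₀ hδ₀ htri
      hlen (hh i) (hhZ i) (hSZ i) (hKP' i) (hlocP' i) (hrowP' i) (hKC' i) (hlocC' i) (hrowC' i) (h342_1 i)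
      (h342_2₂ i) (h342_E i) (hPL i) (hCL i) (hLeib i)
  have hsumE : E ∘ₗ (∑ i, mulOp (h i) * Gsq i * mulOp (h i)) = ∑ i, E ∘ₗ (mulOp (h i) * Gsq i * mulOp (h i)) := by
    apply LinearMap.ext
    intro μ
    rw [LinearMap.comp_apply, LinearMap.sum_apply, LinearMap.sum_apply, map_sum]
    rfl
  have hS₀ : HasMajorantHom (g := toB6 g R H) blk blkZ (E ∘ₗ ∑ i, mulOp (h i) * Gsq i * mulOp (h i))
      (fun (a b : g.Site) => B₀ * (N + N' * Real.exp (δ₀ * ρ) * (κ₃ + κ₄)) * W a *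
        Real.exp (-(δ₀ * g.dist a b))) := by
    rw [hsumE]
    refine hasMajorantHom_mono (g := toB6 g R H) blk blkZ
      (hasMajorantHom_fintypeSum blk blkZ (fun i => E ∘ₗ (mulOp (h i) * Gsq i * mulOp (h i))) _ hcube)
      fun a b => ?_
    have h1 : 0 ≤ B₀ * W a := mul_nonneg hB₀ (hW a)
    have h2 : 0 ≤ B₀ * Real.exp (δ₀ * ρ) * (κ₃ + κ₄) * W a :=
      mul_nonneg (mul_nonneg (mul_nonneg hB₀ (Real.exp_nonneg _)) hκ') (hW a)
    calc (∑ i, ((if a ∈ S i then (1 : ℝ) else 0) * (B₀ * W a) +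
            (if a ∈ S' i then (1 : ℝ) else 0) * (B₀ * Real.exp (δ₀ * ρ) * (κ₃ + κ₄) * W a)) *
            Real.exp (-(δ₀ * g.dist a b)))
        = ((∑ i, if a ∈ S i then (1 : ℝ) else 0) * (B₀ * W a) +
            (∑ i, if a ∈ S' i then (1 : ℝ) else 0) * (B₀ * Real.exp (δ₀ * ρ) * (κ₃ + κ₄) * W a)) *
            Real.exp (-(δ₀ * g.dist a b)) := by
          simp only [Finset.sum_mul, add_mul, Finset.sum_add_distrib]
      _ ≤ (N * (B₀ * W a) + N' * (B₀ * Real.exp (δ₀ * ρ) * (κ₃ + κ₄) * W a)) * Real.exp (-(δ₀ * g.dist a b)) :=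
          mul_le_mul_of_nonneg_right (add_le_add (mul_le_mul_of_nonneg_right (hcnt a) h1)
            (mul_le_mul_of_nonneg_right (hcnt' a) h2)) (Real.exp_nonneg _)
      _ = B₀ * (N + N' * Real.exp (δ₀ * ρ) * (κ₃ + κ₄)) * W a * Real.exp (-(δ₀ * g.dist a b)) := by ring
  -- R′ = Σ_□ K(h_□)G′_□h_□ has majorant N′θe^{−δ₀d} ((3.89) summed, exactly as in `B9Thm37Sum.thm37_entry1`)
  have h389 := h389_of_342 (R := R) (H := H) blk blkY₁ δ₀ ρ B₀ κ₁ κ₂ S' h KP KC hB₀ hδ₀ htri hlen hh hKP hlocP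
    hrowP hKC hlocC hrowC h342_1 h342_2₁ hP hC
  have h389' : ∀ i, HasMajorant (g := toB6 g R H) blk ((P i ∘ₗ D₁ + Cop i) * Gsq i * mulOp (h i))
      (fun (a b : g.Site) => (if a ∈ S' i then (1 : ℝ) else 0) *
        (B₀ * Real.exp (δ₀ * ρ) * (κ₁ + κ₂) * Real.exp (-(δ₀ * g.dist a b)))) :=
    fun i => hasMajorant_mono (g := toB6 g R H) blk (h389 i) fun a b => le_of_eq (by split_ifs <;> simp)
  have hR : HasMajorant (g := toB6 g R H) blk (∑ i, (P i ∘ₗ D₁ + Cop i) * Gsq i * mulOp (h i))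
      (fun (a b : g.Site) => N' * (B₀ * Real.exp (δ₀ * ρ) * (κ₁ + κ₂)) * Real.exp (-(δ₀ * g.dist a b))) := by
    have hloc := hasMajorant_localSum (G := toB6 g R H) blk (fun i => (P i ∘ₗ D₁ + Cop i) * Gsq i * mulOp (h i))
      (fun i (a : g.Site) => if a ∈ S' i then 1 else 0)
      (fun (a b : g.Site) => B₀ * Real.exp (δ₀ * ρ) * (κ₁ + κ₂) * Real.exp (-(δ₀ * g.dist a b))) N'
      (fun a b => mul_nonneg hθ (Real.exp_nonneg _)) h389' hcnt'
    exact hasMajorant_mono (g := toB6 g R H) blk hloc fun a b => le_of_eq (by ring)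
  -- G′ = G′₀ + G′R′ ((3.88)/(3.90)) passes to EG′ = EG′₀ + (EG′)R′; the Neumann series is (2.66) via Lemma 2.1
  have hfix : G' = (∑ i, mulOp (h i) * Gsq i * mulOp (h i)) +
      G' * ∑ i, (P i ∘ₗ D₁ + Cop i) * Gsq i * mulOp (h i) := fixedPoint_of_388 hinv h388
  have hmain := hom_majorant_of_fixedPoint_266 (g := toB6 g R H) blk blkZ d δ₀ α
    (N' * (B₀ * Real.exp (δ₀ * ρ) * (κ₁ + κ₂))) (B₀ * (N + N' * Real.exp (δ₀ * ρ) * (κ₃ + κ₄))) W hA hW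
    (mul_nonneg hN' hθ) hαδ htri hrefl hdnn h261 h263 hsmall hS₀ hR (leftEntry_fixpoint E hfix)
  refine hasMajorantHom_mono (g := toB6 g R H) blk blkZ hmain fun a b => le_of_eq ?_
  simp only [toB6_dist]


end LeftTwoD

/-! ## §2 The RIGHT face with the transposed (3.88) summed over the directions -/

section RightDir

variable {R : ℝ} {H : Prop} {X Y Dir : Type} [Fintype Dir]

omit [Fintype g.Site] [DecidableEq g.Site] in
/-- a nonnegative per-direction kernel below a summed bound is pointwise below it: `KPd μ ≤ Σ_ν KPd ν ≤ KP`. [folklore] [cite: Balaban1984PropagatorsII, (2.40) p.230, bookkeeping] -/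
theorem kernelDir_le {KP : g.Site → g.Site → ℝ} {KPd : Dir → g.Site → g.Site → ℝ} (hKPd : ∀ μ a b, 0 ≤ KPd μ a b)
    (hsum : ∀ a b, (∑ μ, KPd μ a b) ≤ KP a b) (μ : Dir) (a b : g.Site) : KPd μ a b ≤ KP a b :=
  (Finset.single_le_sum (fun ν _ => hKPd ν a b) (Finset.mem_univ μ)).trans (hsum a b)

omit [Fintype g.Site] [DecidableEq g.Site] in
/-- the per-direction kernels inherit the range `ρ` of the summed kernel. [folklore] [cite: Balaban1984PropagatorsII, (2.40) p.230, bookkeeping] -/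
theorem kernelDir_loc {KP : g.Site → g.Site → ℝ} {KPd : Dir → g.Site → g.Site → ℝ} {ρ : ℝ} (hKPd : ∀ μ a b, 0 ≤ KPd μ a b)
    (hsum : ∀ a b, (∑ μ, KPd μ a b) ≤ KP a b) (hloc : ∀ y'' b, KP y'' b ≠ 0 → g.dist y'' b ≤ ρ) (μ : Dir) (y'' b : g.Site)
    (h : KPd μ y'' b ≠ 0) : g.dist y'' b ≤ ρ := by
  refine hloc y'' b fun h0 => h ?_
  exact le_antisymm (h0 ▸ kernelDir_le hKPd hsum μ y'' b) (hKPd μ y'' b)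

/-- ★ **ONE TERM OF `V = Σ_□ h_□G′_□K(h_□)ᵗ` WITH `K(h_□)ᵗ = Σ_μ ∇*_{U,μ}Pᵗ_{□,μ} + Cᵗ_□` SUMMED OVER THE DIRECTIONS** (`rightR_cube_majorant` with the
transposed (3.88) over the direction letters): `h_□G′_□(Σ_μ ∇*_μPᵗ_μ + Cᵗ_□) = Σ_μ h_□(G′_□∇*_μ)Pᵗ_μ + h_□G′_□Cᵗ_□`; each direction by entry 3 of (3.42) for `G′_□∇*_μ`
followed by the local `Pᵗ_μ` (column kernel `KPd μ`, `hom_majorant_comp_localRight`), the direction sum taken ON THE KERNELS (`Σ_μ Σ_{y″} KPd μ y″ b ≤ Σ_{y″} KPt y″ b`), so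
the majorant is v1's `1_{S′_□}(y′)B₀e^{δ₀ρ}(κ₁ + C_ℓκ₂)·Lʲη(L^{j′}η)⁻¹·e^{−δ₀d(y,y′)}` with NO factor `#Dir`.
[cite: Balaban1985BackgroundPropagators, (3.88)–(3.89) p.409; Balaban1984PropagatorsII, (2.40)–(2.44) p.230, (2.52)–(2.55) p.232] -/
theorem rightR_cube_majorant_dir (blk : X → g.Site) (δ₀ ρ B₀ κ₁ κ₂ Cℓ : ℝ)
    (S S' : Finset g.Site) (h : X → ℝ) (KP KC : g.Site → g.Site → ℝ) (KPd : Dir → g.Site → g.Site → ℝ)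
    (hB₀ : 0 ≤ B₀) (hδ₀ : 0 ≤ δ₀) (hκ₁ : 0 ≤ κ₁) (hκ₂ : 0 ≤ κ₂) (hCℓ : 0 ≤ Cℓ) (htri : Triangle254 (toB6 g R H))
    (hlenpos : ∀ y : g.Site, 0 < g.len y)
    (hh : ∀ x, |h x| ≤ 1) (hS : ∀ x, h x ≠ 0 → blk x ∈ S)
    (hcomp : ∀ a b : g.Site, a ∈ S → b ∈ S' → g.len a ≤ Cℓ * g.len b)
    (hlocP : ∀ y'' b, KP y'' b ≠ 0 → g.dist y'' b ≤ ρ)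
    (hcolP : ∀ b : g.Site, (∑ y'' : g.Site, KP y'' b) * g.len b ≤ if b ∈ S' then κ₁ else 0)
    (hKPd : ∀ μ a b, 0 ≤ KPd μ a b) (hKPd_sum : ∀ a b, (∑ μ, KPd μ a b) ≤ KP a b)
    (hKC : ∀ a b, 0 ≤ KC a b) (hlocC : ∀ y'' b, KC y'' b ≠ 0 → g.dist y'' b ≤ ρ)
    (hcolC : ∀ b : g.Site, (∑ y'' : g.Site, KC y'' b) * g.len b ^ 2 ≤ if b ∈ S' then κ₂ else 0)
    {Gsq Ct : Module.End ℝ (X → ℝ)} {Dsd Pt : Dir → Module.End ℝ (X → ℝ)}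
    (h342_1 : HasMajorant (g := toB6 g R H) blk Gsq (fun a b => B₀ * g.len a ^ 2 * Real.exp (-(δ₀ * g.dist a b))))
    (h342_3d : ∀ μ, HasMajorant (g := toB6 g R H) blk (Gsq ∘ₗ Dsd μ)
      (fun a b => B₀ * g.len a * Real.exp (-(δ₀ * g.dist a b))))
    (hPt : ∀ μ, HasMajorant (g := toB6 g R H) blk (Pt μ) (KPd μ)) (hCt : HasMajorant (g := toB6 g R H) blk Ct KC) :
    HasMajorant (g := toB6 g R H) blk (mulOp h * Gsq * ((∑ μ, Dsd μ * Pt μ) + Ct))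
      (fun (a b : g.Site) => (if b ∈ S' then (1 : ℝ) else 0) * (B₀ * Real.exp (δ₀ * ρ) * (κ₁ + Cℓ * κ₂)) *
        (g.len a * (g.len b)⁻¹) * Real.exp (-(δ₀ * g.dist a b))) := by
  have hlen0 : ∀ y : g.Site, 0 ≤ g.len y := fun y => (hlenpos y).le
  have hsplit : mulOp h * Gsq * ((∑ μ, Dsd μ * Pt μ) + Ct) =
      (∑ μ, mulOp h ∘ₗ ((Gsq ∘ₗ Dsd μ) ∘ₗ Pt μ)) + mulOp h ∘ₗ (Gsq ∘ₗ Ct) := by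
    rw [mul_add, Finset.mul_sum]
    simp only [Module.End.mul_eq_comp, LinearMap.comp_assoc]
  have hcolP' : ∀ b : g.Site, ∑ y'' : g.Site, KP y'' b ≤ (if b ∈ S' then κ₁ else 0) * (g.len b)⁻¹ := by
    intro b
    rw [← div_eq_mul_inv, le_div_iff₀ (hlenpos b)]
    exact hcolP b
  have hcolC' : ∀ b : g.Site, ∑ y'' : g.Site, KC y'' b ≤ (if b ∈ S' then κ₂ else 0) * (g.len b ^ 2)⁻¹ := by
    intro b
    rw [← div_eq_mul_inv, le_div_iff₀ (pow_pos (hlenpos b) 2)]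
    exact hcolC b
  -- h_□(G′_□∇*_μ)Pᵗ_μ, per direction: entry 3 followed by the local Pᵗ_μ with its own column sums
  have hPμ : ∀ μ, HasMajorantHom (g := toB6 g R H) blk blk ((Gsq ∘ₗ Dsd μ) ∘ₗ Pt μ)
      (fun (a b : g.Site) => B₀ * Real.exp (δ₀ * ρ) * g.len a * (∑ y'' : g.Site, KPd μ y'' b) *
        Real.exp (-(δ₀ * g.dist a b))) := by
    intro μ
    refine hasMajorantHom_mono (g := toB6 g R H) blk blk (hom_majorant_comp_localRight (g := toB6 g R H) blk blk
      blk δ₀ ρ B₀ (fun (a : g.Site) => g.len a) (fun (b : g.Site) => ∑ y'' : g.Site, KPd μ y'' b)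
      (KPd μ) hB₀ hlen0 hδ₀ htri (hKPd μ) (kernelDir_loc hKPd hKPd_sum hlocP μ) (fun b => le_rfl)
      ((hasMajorantHom_iff (g := toB6 g R H) blk _ _).mpr (h342_3d μ))
      ((hasMajorantHom_iff (g := toB6 g R H) blk _ _).mpr (hPt μ))) fun a b => le_of_eq ?_
    simp only [toB6_dist]
  -- the direction sum on the kernels
  have hP0 : HasMajorantHom (g := toB6 g R H) blk blk (∑ μ, (Gsq ∘ₗ Dsd μ) ∘ₗ Pt μ)
      (fun (a b : g.Site) => B₀ * Real.exp (δ₀ * ρ) * g.len a * ((if b ∈ S' then κ₁ else 0) * (g.len b)⁻¹) *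
        Real.exp (-(δ₀ * g.dist a b))) := by
    refine hasMajorantHom_mono (g := toB6 g R H) blk blk
      (hasMajorantHom_fintypeSum blk blk (fun μ => (Gsq ∘ₗ Dsd μ) ∘ₗ Pt μ) _ hPμ) fun (a b : g.Site) => ?_
    have hswap : (∑ μ, ∑ y'' : g.Site, KPd μ y'' b) ≤ (if b ∈ S' then κ₁ else 0) * (g.len b)⁻¹ := by
      rw [Finset.sum_comm]
      exact (Finset.sum_le_sum fun y'' _ => hKPd_sum y'' b).trans (hcolP' b)
    have hc : 0 ≤ B₀ * Real.exp (δ₀ * ρ) * g.len a := mul_nonneg (mul_nonneg hB₀ (Real.exp_nonneg _)) (hlen0 a)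
    calc (∑ μ, B₀ * Real.exp (δ₀ * ρ) * g.len a * (∑ y'' : g.Site, KPd μ y'' b) * Real.exp (-(δ₀ * g.dist a b)))
        = B₀ * Real.exp (δ₀ * ρ) * g.len a * (∑ μ, ∑ y'' : g.Site, KPd μ y'' b) * Real.exp (-(δ₀ * g.dist a b)) := by
          rw [Finset.mul_sum, Finset.sum_mul]
      _ ≤ B₀ * Real.exp (δ₀ * ρ) * g.len a * ((if b ∈ S' then κ₁ else 0) * (g.len b)⁻¹) * Real.exp (-(δ₀ * g.dist a b)) :=
          mul_le_mul_of_nonneg_right (mul_le_mul_of_nonneg_left hswap hc) (Real.exp_nonneg _)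
  -- h_□G′_□Cᵗ_□: entry 1 followed by the local Cᵗ_□
  have hC0 : HasMajorantHom (g := toB6 g R H) blk blk (Gsq ∘ₗ Ct)
      (fun (a b : g.Site) => B₀ * Real.exp (δ₀ * ρ) * (g.len a ^ 2) * ((if b ∈ S' then κ₂ else 0) * (g.len b ^ 2)⁻¹) *
        Real.exp (-(δ₀ * g.dist a b))) := by
    refine hasMajorantHom_mono (g := toB6 g R H) blk blk (hom_majorant_comp_localRight (g := toB6 g R H) blk blk
      blk δ₀ ρ B₀ (fun (a : g.Site) => g.len a ^ 2) (fun (b : g.Site) => (if b ∈ S' then κ₂ else 0) * (g.len b ^ 2)⁻¹)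
      KC hB₀ (fun y => sq_nonneg _) hδ₀ htri hKC hlocC hcolC'
      ((hasMajorantHom_iff (g := toB6 g R H) blk Gsq _).mpr h342_1)
      ((hasMajorantHom_iff (g := toB6 g R H) blk Ct _).mpr hCt)) fun a b => le_of_eq ?_
    simp only [toB6_dist]
  have hP := hasMajorantHom_mulOp_local blk blk hP0 h hh S hS
  have hC := hasMajorantHom_mulOp_local blk blk hC0 h hh S hS
  have hsumh : (∑ μ, mulOp h ∘ₗ ((Gsq ∘ₗ Dsd μ) ∘ₗ Pt μ)) = mulOp h ∘ₗ (∑ μ, (Gsq ∘ₗ Dsd μ) ∘ₗ Pt μ) := by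
    apply LinearMap.ext; intro f
    simp only [LinearMap.sum_apply, LinearMap.comp_apply, map_sum]
  rw [hsplit, hsumh, ← hasMajorantHom_iff (g := toB6 g R H) blk]
  refine hasMajorantHom_mono (g := toB6 g R H) blk blk (hasMajorantHom_add (g := toB6 g R H) blk blk hP hC)
    fun (a b : g.Site) => ?_
  have hE : 0 ≤ Real.exp (-(δ₀ * g.dist a b)) := Real.exp_nonneg _
  show (if a ∈ S then B₀ * Real.exp (δ₀ * ρ) * g.len a * ((if b ∈ S' then κ₁ else 0) * (g.len b)⁻¹) *
        Real.exp (-(δ₀ * g.dist a b)) else 0) +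
      (if a ∈ S then B₀ * Real.exp (δ₀ * ρ) * (g.len a ^ 2) * ((if b ∈ S' then κ₂ else 0) * (g.len b ^ 2)⁻¹) *
        Real.exp (-(δ₀ * g.dist a b)) else 0) ≤
    (if b ∈ S' then (1 : ℝ) else 0) * (B₀ * Real.exp (δ₀ * ρ) * (κ₁ + Cℓ * κ₂)) * (g.len a * (g.len b)⁻¹) *
      Real.exp (-(δ₀ * g.dist a b))
  by_cases hb : b ∈ S'
  · by_cases ha : a ∈ S
    · have hq0 : 0 ≤ g.len a * (g.len b)⁻¹ := mul_nonneg (hlen0 a) (inv_nonneg.mpr (hlen0 b))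
      have hq : g.len a * (g.len b)⁻¹ ≤ Cℓ := by
        rw [← div_eq_mul_inv, div_le_iff₀ (hlenpos b)]
        exact hcomp a b ha hb
      have hsq : g.len a ^ 2 * (g.len b ^ 2)⁻¹ ≤ Cℓ * (g.len a * (g.len b)⁻¹) :=
        calc g.len a ^ 2 * (g.len b ^ 2)⁻¹ = (g.len a * (g.len b)⁻¹) * (g.len a * (g.len b)⁻¹) := by
              rw [← inv_pow]; ring
          _ ≤ Cℓ * (g.len a * (g.len b)⁻¹) := mul_le_mul_of_nonneg_right hq hq0
      have h0 : 0 ≤ B₀ * Real.exp (δ₀ * ρ) * κ₂ * Real.exp (-(δ₀ * g.dist a b)) :=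
        mul_nonneg (mul_nonneg (mul_nonneg hB₀ (Real.exp_nonneg _)) hκ₂) hE
      rw [if_pos ha, if_pos ha, if_pos hb, if_pos hb, if_pos hb]
      calc B₀ * Real.exp (δ₀ * ρ) * g.len a * (κ₁ * (g.len b)⁻¹) * Real.exp (-(δ₀ * g.dist a b)) +
            B₀ * Real.exp (δ₀ * ρ) * g.len a ^ 2 * (κ₂ * (g.len b ^ 2)⁻¹) * Real.exp (-(δ₀ * g.dist a b))
          = B₀ * Real.exp (δ₀ * ρ) * κ₁ * (g.len a * (g.len b)⁻¹) * Real.exp (-(δ₀ * g.dist a b)) +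
            B₀ * Real.exp (δ₀ * ρ) * κ₂ * Real.exp (-(δ₀ * g.dist a b)) * (g.len a ^ 2 * (g.len b ^ 2)⁻¹) := by
              ring
        _ ≤ B₀ * Real.exp (δ₀ * ρ) * κ₁ * (g.len a * (g.len b)⁻¹) * Real.exp (-(δ₀ * g.dist a b)) +
            B₀ * Real.exp (δ₀ * ρ) * κ₂ * Real.exp (-(δ₀ * g.dist a b)) * (Cℓ * (g.len a * (g.len b)⁻¹)) :=
              add_le_add le_rfl (mul_le_mul_of_nonneg_left hsq h0)
        _ = (1 : ℝ) * (B₀ * Real.exp (δ₀ * ρ) * (κ₁ + Cℓ * κ₂)) * (g.len a * (g.len b)⁻¹) *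
            Real.exp (-(δ₀ * g.dist a b)) := by ring
    · rw [if_neg ha, if_neg ha, if_pos hb]
      have h2 : 0 ≤ (1 : ℝ) * (B₀ * Real.exp (δ₀ * ρ) * (κ₁ + Cℓ * κ₂)) * (g.len a * (g.len b)⁻¹) *
          Real.exp (-(δ₀ * g.dist a b)) :=
        mul_nonneg (mul_nonneg (mul_nonneg zero_le_one (mul_nonneg (mul_nonneg hB₀ (Real.exp_nonneg _))
          (add_nonneg hκ₁ (mul_nonneg hCℓ hκ₂)))) (mul_nonneg (hlen0 a) (inv_nonneg.mpr (hlen0 b)))) hE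
      rw [add_zero]
      exact h2
  · rw [if_neg hb, if_neg hb, if_neg hb]
    split_ifs
    · exact le_of_eq (by ring)
    · exact le_of_eq (by ring)


/-- ★ **THEOREM 3.7 ⇒ ENTRY 3 OF (3.42) FOR G′ — THE RIGHT FACE WITH THE TRANSPOSED (3.88) OVER THE DIRECTION LETTERS** (`B9Thm37Glue.thm37_rightEntry_of_342`
with `K(h_□)ᵗ = Σ_μ ∇*_{U,μ}Pᵗ_{□,μ} + Cᵗ_□`): the E-role `D*` (the entry `G′D*`, the right Leibniz rule `hLeibT`) is the slice letter `Dstar : Y → X` as in v1; the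
R′-role is the direction family `Dsd μ`, `Pt □ μ : End X` with per-direction entry 3 of the cube operators (`h342_3d`) and per-direction COLUMN kernels `KPd □ μ`
summing below `KP □`; the transposed (3.88) is `h388T : G′₀Δ′_a = 1 − Σ_□ h_□G′_□((Σ_μ ∇*_μPᵗ_{□,μ}) + Cᵗ_□)`.  Same constants, smallness and conclusion as v1
(the direction sum is taken on the kernels).
[cite: Balaban1985BackgroundPropagators, Thm 3.7 (3.87)–(3.90) pp.409–410, (3.42) p.397; Balaban1984PropagatorsII, Prop 2.2 (2.64)–(2.67) p.234] -/
theorem thm37_rightEntry_of_342_dir [Fintype X] [DecidableEq X] [Fintype Y] [DecidableEq Y]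
    (blk : X → g.Site) (blkY : Y → g.Site) (d : ℕ) (δ₀ α ρ B₀ κ₁ κ₂ κ₄ Cℓ N N' : ℝ) {ι : Type} [Fintype ι]
    (S S' : ι → Finset g.Site) (h : ι → X → ℝ) (hY : ι → Y → ℝ) (KP KC KC' : ι → g.Site → g.Site → ℝ)
    (KPd : ι → Dir → g.Site → g.Site → ℝ) {G' Δ : Module.End ℝ (X → ℝ)}
    (hB₀ : 0 ≤ B₀) (hδ₀ : 0 ≤ δ₀) (hκ₁ : 0 ≤ κ₁) (hκ₂ : 0 ≤ κ₂) (hκ₄ : 0 ≤ κ₄) (hCℓ : 0 ≤ Cℓ) (hN : 0 ≤ N)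
    (hN' : 0 ≤ N') (hαδ : 0 ≤ α * δ₀) (hαδ2 : 0 ≤ (1 - 2 * α) * δ₀)
    (htri : Triangle254 (toB6 g R H)) (hrefl : ∀ y : g.Site, g.dist y y = 0)
    (hsym : ∀ y y' : g.Site, g.dist y y' = g.dist y' y) (hdnn : ∀ y y' : g.Site, 0 ≤ g.dist y y')
    (hlenpos : ∀ y : g.Site, 0 < g.len y)
    (h261 : Ineq261 d (toB6 g R H) δ₀ α) (h263 : Ineq263 d (toB6 g R H) δ₀ α)
    (hsmall : N' * (B₀ * Real.exp (δ₀ * ρ) * (κ₁ + Cℓ * κ₂)) * B6.c1 d δ₀ α < 1)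
    (hh : ∀ i x, |h i x| ≤ 1) (hS : ∀ i x, h i x ≠ 0 → blk x ∈ S i) (hhY : ∀ i v, |hY i v| ≤ 1)
    (hcnt : ∀ a : g.Site, (∑ i, if a ∈ S i then (1 : ℝ) else 0) ≤ N)
    (hcnt' : ∀ b : g.Site, (∑ i, if b ∈ S' i then (1 : ℝ) else 0) ≤ N')
    (hcomp : ∀ i (a b : g.Site), a ∈ S i → b ∈ S' i → g.len a ≤ Cℓ * g.len b)
    (hlocP : ∀ i y'' b, KP i y'' b ≠ 0 → g.dist y'' b ≤ ρ)
    (hcolP : ∀ i (b : g.Site), (∑ y'' : g.Site, KP i y'' b) * g.len b ≤ if b ∈ S' i then κ₁ else 0)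
    (hKPd : ∀ i μ a b, 0 ≤ KPd i μ a b) (hKPd_sum : ∀ i a b, (∑ μ, KPd i μ a b) ≤ KP i a b)
    (hKC : ∀ i a b, 0 ≤ KC i a b) (hlocC : ∀ i y'' b, KC i y'' b ≠ 0 → g.dist y'' b ≤ ρ)
    (hcolC : ∀ i (b : g.Site), (∑ y'' : g.Site, KC i y'' b) * g.len b ^ 2 ≤ if b ∈ S' i then κ₂ else 0)
    (hKC' : ∀ i a b, 0 ≤ KC' i a b) (hlocC' : ∀ i y'' b, KC' i y'' b ≠ 0 → g.dist y'' b ≤ ρ)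
    (hcolC' : ∀ i (b : g.Site), (∑ y'' : g.Site, KC' i y'' b) * g.len b ≤ if b ∈ S' i then κ₄ else 0)
    {Gsq Ct : ι → Module.End ℝ (X → ℝ)} {Dstar : (Y → ℝ) →ₗ[ℝ] (X → ℝ)} {Dsd : Dir → Module.End ℝ (X → ℝ)}
    {Pt : ι → Dir → Module.End ℝ (X → ℝ)} {CLt : ι → (Y → ℝ) →ₗ[ℝ] (X → ℝ)}
    (h342_1 : ∀ i, HasMajorant (g := toB6 g R H) blk (Gsq i)
      (fun a b => B₀ * g.len a ^ 2 * Real.exp (-(δ₀ * g.dist a b))))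
    (h342_3 : ∀ i, HasMajorantHom (g := toB6 g R H) blkY blk (Gsq i ∘ₗ Dstar)
      (fun a b => B₀ * g.len a * Real.exp (-(δ₀ * g.dist a b))))
    (h342_3d : ∀ i μ, HasMajorant (g := toB6 g R H) blk (Gsq i ∘ₗ Dsd μ)
      (fun a b => B₀ * g.len a * Real.exp (-(δ₀ * g.dist a b))))
    (hPt : ∀ i μ, HasMajorant (g := toB6 g R H) blk (Pt i μ) (KPd i μ))
    (hCt : ∀ i, HasMajorant (g := toB6 g R H) blk (Ct i) (KC i))
    (hCLt : ∀ i, HasMajorantHom (g := toB6 g R H) blkY blk (CLt i) (KC' i))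
    (hLeibT : ∀ i, mulOp (h i) ∘ₗ Dstar = Dstar ∘ₗ mulOp (hY i) + CLt i)
    (hinv : G' * Δ = 1)
    (h388T : (∑ i, mulOp (h i) * Gsq i * mulOp (h i)) * Δ = 1 - ∑ i, mulOp (h i) * Gsq i * ((∑ μ, Dsd μ * Pt i μ) + Ct i)) :
    HasMajorantHom (g := toB6 g R H) blkY blk (G' ∘ₗ Dstar)
      (fun (a b : g.Site) => B₀ * (N + N' * Real.exp (δ₀ * ρ) * Cℓ * κ₄) * B6.c1 d δ₀ α *
        (1 - N' * (B₀ * Real.exp (δ₀ * ρ) * (κ₁ + Cℓ * κ₂)) * B6.c1 d δ₀ α)⁻¹ * g.len a *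
        Real.exp (-((1 - 2 * α) * δ₀ * g.dist a b))) := by
  have hlen0 : ∀ y : g.Site, 0 ≤ g.len y := fun y => (hlenpos y).le
  have hθ : 0 ≤ N' * (B₀ * Real.exp (δ₀ * ρ) * (κ₁ + Cℓ * κ₂)) :=
    mul_nonneg hN' (mul_nonneg (mul_nonneg hB₀ (Real.exp_nonneg _)) (add_nonneg hκ₁ (mul_nonneg hCℓ hκ₂)))
  have hA : 0 ≤ B₀ * (N + N' * Real.exp (δ₀ * ρ) * Cℓ * κ₄) :=
    mul_nonneg hB₀ (add_nonneg hN (mul_nonneg (mul_nonneg (mul_nonneg hN' (Real.exp_nonneg _)) hCℓ) hκ₄))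
  -- T₀ = G′₀D* = Σ_□ h_□G′_□h_□D*: a finite sum of localized two-space operators
  have hcube : ∀ i, HasMajorantHom (g := toB6 g R H) blkY blk ((mulOp (h i) * Gsq i * mulOp (h i)) ∘ₗ Dstar)
      (fun (a b : g.Site) => ((if a ∈ S i then (1 : ℝ) else 0) * (B₀ * g.len a) +
        (if b ∈ S' i then (1 : ℝ) else 0) * (B₀ * Real.exp (δ₀ * ρ) * Cℓ * κ₄ * g.len a)) *
        Real.exp (-(δ₀ * g.dist a b))) := fun i =>
    rightEntry_cube_majorant blk blkY δ₀ ρ B₀ κ₄ Cℓ (S i) (S' i) (h i) (hY i) (KC' i) hB₀ hδ₀ hκ₄ hCℓ htri hlenpos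
      (hh i) (hS i) (hhY i) (hcomp i) (hKC' i) (hlocC' i) (hcolC' i) (h342_1 i) (h342_3 i) (hCLt i) (hLeibT i)
  have hsumD : (∑ i, mulOp (h i) * Gsq i * mulOp (h i)) ∘ₗ Dstar = ∑ i, (mulOp (h i) * Gsq i * mulOp (h i)) ∘ₗ Dstar := by
    apply LinearMap.ext
    intro μ
    simp only [LinearMap.comp_apply, LinearMap.sum_apply]
  have hT₀ : HasMajorantHom (g := toB6 g R H) blkY blk ((∑ i, mulOp (h i) * Gsq i * mulOp (h i)) ∘ₗ Dstar)
      (fun (a b : g.Site) => B₀ * (N + N' * Real.exp (δ₀ * ρ) * Cℓ * κ₄) * g.len a * 1 *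
        Real.exp (-(δ₀ * g.dist a b))) := by
    rw [hsumD]
    refine hasMajorantHom_mono (g := toB6 g R H) blkY blk
      (hasMajorantHom_fintypeSum blkY blk (fun i => (mulOp (h i) * Gsq i * mulOp (h i)) ∘ₗ Dstar) _ hcube)
      fun (a b : g.Site) => ?_
    have h1 : 0 ≤ B₀ * g.len a := mul_nonneg hB₀ (hlen0 a)
    have h2 : 0 ≤ B₀ * Real.exp (δ₀ * ρ) * Cℓ * κ₄ * g.len a :=
      mul_nonneg (mul_nonneg (mul_nonneg (mul_nonneg hB₀ (Real.exp_nonneg _)) hCℓ) hκ₄) (hlen0 a)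
    calc (∑ i, ((if a ∈ S i then (1 : ℝ) else 0) * (B₀ * g.len a) +
            (if b ∈ S' i then (1 : ℝ) else 0) * (B₀ * Real.exp (δ₀ * ρ) * Cℓ * κ₄ * g.len a)) *
            Real.exp (-(δ₀ * g.dist a b)))
        = ((∑ i, if a ∈ S i then (1 : ℝ) else 0) * (B₀ * g.len a) +
            (∑ i, if b ∈ S' i then (1 : ℝ) else 0) * (B₀ * Real.exp (δ₀ * ρ) * Cℓ * κ₄ * g.len a)) *
            Real.exp (-(δ₀ * g.dist a b)) := by
          simp only [Finset.sum_mul, add_mul, Finset.sum_add_distrib]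
      _ ≤ (N * (B₀ * g.len a) + N' * (B₀ * Real.exp (δ₀ * ρ) * Cℓ * κ₄ * g.len a)) * Real.exp (-(δ₀ * g.dist a b)) :=
          mul_le_mul_of_nonneg_right (add_le_add (mul_le_mul_of_nonneg_right (hcnt a) h1)
            (mul_le_mul_of_nonneg_right (hcnt' b) h2)) (Real.exp_nonneg _)
      _ = B₀ * (N + N' * Real.exp (δ₀ * ρ) * Cℓ * κ₄) * g.len a * 1 * Real.exp (-(δ₀ * g.dist a b)) := by ring
  -- V = Σ_□ h_□G′_□(D*Pᵗ_□ + Cᵗ_□) has the scale-weighted majorant N′θ·L^jη(L^{j′}η)^{−1}e^{−δ₀d}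
  have hVi : ∀ i, HasMajorantHom (g := toB6 g R H) blk blk (mulOp (h i) * Gsq i * ((∑ μ, Dsd μ * Pt i μ) + Ct i))
      (fun (a b : g.Site) => (if b ∈ S' i then (1 : ℝ) else 0) * (B₀ * Real.exp (δ₀ * ρ) * (κ₁ + Cℓ * κ₂)) *
        (g.len a * (g.len b)⁻¹) * Real.exp (-(δ₀ * g.dist a b))) := fun i =>
    (hasMajorantHom_iff (g := toB6 g R H) blk _ _).mpr
      (rightR_cube_majorant_dir blk δ₀ ρ B₀ κ₁ κ₂ Cℓ (S i) (S' i) (h i) (KP i) (KC i) (KPd i) hB₀ hδ₀ hκ₁ hκ₂ hCℓ htri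
        hlenpos (hh i) (hS i) (hcomp i) (hlocP i) (hcolP i) (hKPd i) (hKPd_sum i) (hKC i) (hlocC i) (hcolC i)
        (h342_1 i) (h342_3d i) (hPt i) (hCt i))
  have hV : HasMajorant (g := toB6 g R H) blk (∑ i, mulOp (h i) * Gsq i * ((∑ μ, Dsd μ * Pt i μ) + Ct i))
      (fun (a b : g.Site) => N' * (B₀ * Real.exp (δ₀ * ρ) * (κ₁ + Cℓ * κ₂)) * g.len a * (g.len b)⁻¹ *
        Real.exp (-(δ₀ * g.dist a b))) := by
    rw [← hasMajorantHom_iff (g := toB6 g R H) blk]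
    refine hasMajorantHom_mono (g := toB6 g R H) blk blk
      (hasMajorantHom_fintypeSum blk blk (fun i => mulOp (h i) * Gsq i * ((∑ μ, Dsd μ * Pt i μ) + Ct i)) _ hVi)
      fun (a b : g.Site) => ?_
    have h3 : 0 ≤ B₀ * Real.exp (δ₀ * ρ) * (κ₁ + Cℓ * κ₂) * (g.len a * (g.len b)⁻¹) * Real.exp (-(δ₀ * g.dist a b)) :=
      mul_nonneg (mul_nonneg (mul_nonneg (mul_nonneg hB₀ (Real.exp_nonneg _)) (add_nonneg hκ₁ (mul_nonneg hCℓ hκ₂)))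
        (mul_nonneg (hlen0 a) (inv_nonneg.mpr (hlen0 b)))) (Real.exp_nonneg _)
    calc (∑ i, (if b ∈ S' i then (1 : ℝ) else 0) * (B₀ * Real.exp (δ₀ * ρ) * (κ₁ + Cℓ * κ₂)) *
            (g.len a * (g.len b)⁻¹) * Real.exp (-(δ₀ * g.dist a b)))
        = (∑ i, if b ∈ S' i then (1 : ℝ) else 0) * (B₀ * Real.exp (δ₀ * ρ) * (κ₁ + Cℓ * κ₂) *
            (g.len a * (g.len b)⁻¹) * Real.exp (-(δ₀ * g.dist a b))) := by
          rw [Finset.sum_mul]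
          exact Finset.sum_congr rfl fun i _ => by ring
      _ ≤ N' * (B₀ * Real.exp (δ₀ * ρ) * (κ₁ + Cℓ * κ₂) * (g.len a * (g.len b)⁻¹) * Real.exp (-(δ₀ * g.dist a b))) :=
          mul_le_mul_of_nonneg_right (hcnt' b) h3
      _ = N' * (B₀ * Real.exp (δ₀ * ρ) * (κ₁ + Cℓ * κ₂)) * g.len a * (g.len b)⁻¹ * Real.exp (-(δ₀ * g.dist a b)) := by
          ring
  -- the transposed (3.88): G′D* = G′₀D* + V(G′D*)
  have hG : G' = (∑ i, mulOp (h i) * Gsq i * mulOp (h i)) +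
      (∑ i, mulOp (h i) * Gsq i * ((∑ μ, Dsd μ * Pt i μ) + Ct i)) * G' :=
    fixedPoint_of_388T (mul_eq_one_comm.mp hinv) h388T
  have hfix : G' ∘ₗ Dstar = (∑ i, mulOp (h i) * Gsq i * mulOp (h i)) ∘ₗ Dstar +
      (∑ i, mulOp (h i) * Gsq i * ((∑ μ, Dsd μ * Pt i μ) + Ct i)) ∘ₗ (G' ∘ₗ Dstar) := by
    conv_lhs => rw [hG]
    rw [LinearMap.add_comp, Module.End.mul_eq_comp, LinearMap.comp_assoc]
  have htransfer : ∀ a b : g.Site, (1 : ℝ) ≤ 1 * 1 * Real.exp (α * δ₀ * g.dist a b) := fun a b => by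
    rw [one_mul, one_mul]
    exact Real.one_le_exp (mul_nonneg hαδ (hdnn a b))
  have hmain := hom_majorant_of_leftFixedPoint_weighted (g := toB6 g R H) blk blkY d δ₀ α
    (N' * (B₀ * Real.exp (δ₀ * ρ) * (κ₁ + Cℓ * κ₂))) (B₀ * (N + N' * Real.exp (δ₀ * ρ) * Cℓ * κ₄)) 1
    (fun y => g.len y) (fun _ => (1 : ℝ)) hA zero_le_one hlenpos (fun _ => zero_le_one) hθ hαδ hαδ2 htri hrefl hsym
    hdnn h261 h263 hsmall htransfer hT₀ hV hfix
  refine hasMajorantHom_mono (g := toB6 g R H) blkY blk hmain fun (a b : g.Site) => le_of_eq ?_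
  simp only [toB6_dist]
  ring


end RightDir

/-! ## §3 Theorem 3.7 at one member and one U over `Identities₂`; the whole printed leaf -/

section Whole

omit [Fintype g.Site] [DecidableEq g.Site] in
/-- Arithmetic of «M sufficiently large»: a constant A(1 − q)⁻¹ with q ≦ ½ and A ≦ A′ is ≦ 2A′, against nonnegative weights and a larger exponential
factor (copy of the lineage's private helper). [folklore] [cite: Balaban1985BackgroundPropagators, Thm 3.7 p.409 («for M sufficiently large»), bookkeeping] -/
private theorem weaken {A A' q w e e' : ℝ} (hA : 0 ≤ A) (hAA' : A ≤ A') (hq : q ≤ 1 / 2) (hw : 0 ≤ w) (he : 0 ≤ e)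
    (hee' : e ≤ e') : A * (1 - q)⁻¹ * w * e ≤ 2 * A' * w * e' := by
  have hinv : (1 - q)⁻¹ ≤ 2 := by
    rw [inv_le_comm₀ (by linarith) (by norm_num : (0 : ℝ) < 2)]
    linarith
  have h1 : A * (1 - q)⁻¹ ≤ 2 * A' :=
    calc A * (1 - q)⁻¹ ≤ A * 2 := mul_le_mul_of_nonneg_left hinv hA
      _ ≤ A' * 2 := mul_le_mul_of_nonneg_right hAA' (by norm_num)
      _ = 2 * A' := by ring
  have hA' : 0 ≤ 2 * A' := by linarith
  calc A * (1 - q)⁻¹ * w * e = (A * (1 - q)⁻¹) * (w * e) := by ring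
    _ ≤ (2 * A') * (w * e') :=
        mul_le_mul h1 (mul_le_mul_of_nonneg_left hee' hw) (mul_nonneg hw he) hA'
    _ = 2 * A' * w * e' := by ring

omit [Fintype g.Site] [DecidableEq g.Site] in
/-- Monotonicity of the entry constants B₀(N + N′e^{δ₀ρ}s)c₁ in the size letter s (copy of the lineage's private helper). [folklore]
[cite: Balaban1985BackgroundPropagators, Thm 3.7 p.409, bookkeeping] -/
private theorem constA_le {B₀ N N' ex s t c : ℝ} (hB₀ : 0 ≤ B₀) (hN'e : 0 ≤ N' * ex) (hc : 0 ≤ c) (hst : s ≤ t) :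
    B₀ * (N + N' * ex * s) * c ≤ B₀ * (N + N' * ex * t) * c := by
  have h1 : N' * ex * s ≤ N' * ex * t := mul_le_mul_of_nonneg_left hst hN'e
  have h2 : N + N' * ex * s ≤ N + N' * ex * t := by linarith
  exact mul_le_mul_of_nonneg_right (mul_le_mul_of_nonneg_left h2 hB₀) hc

omit [Fintype g.Site] [DecidableEq g.Site] in
/-- Arithmetic of «for M sufficiently large»: a size s ≦ θ₀M⁻¹ and M ≧ 2N′B₀e^{δ₀ρ}θ₀c₁ give N′B₀e^{δ₀ρ}sc₁ ≦ ½ (copy of the lineage's private helper).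
[folklore] [cite: Balaban1985BackgroundPropagators, Thm 3.7 p.409 («for M sufficiently large»), bookkeeping] -/
private theorem small_of_size {N' B₀ ex s θ₀ c M : ℝ} (hN' : 0 ≤ N') (hB : 0 ≤ B₀ * ex) (hc : 0 ≤ c) (hM : 0 < M)
    (hs : s ≤ θ₀ * M⁻¹) (hbig : 2 * N' * (B₀ * ex * θ₀) * c ≤ M) : N' * (B₀ * ex * s) * c ≤ 1 / 2 := by
  have h1 : N' * (B₀ * ex * s) * c ≤ N' * (B₀ * ex * (θ₀ * M⁻¹)) * c :=
    mul_le_mul_of_nonneg_right (mul_le_mul_of_nonneg_left (mul_le_mul_of_nonneg_left hs hB) hN') hc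
  have h2 : N' * (B₀ * ex * (θ₀ * M⁻¹)) * c = (N' * (B₀ * ex * θ₀) * c) / M := by
    rw [div_eq_mul_inv]
    ring
  have h3 : (N' * (B₀ * ex * θ₀) * c) / M ≤ 1 / 2 := by
    rw [div_le_iff₀ hM]
    linarith
  exact h1.trans (h2.le.trans h3)

variable {B : B9.Backgrounds} {X Y ι Dir : Type}

/-- ★★ **THEOREM 3.7 AT ONE MEMBER AND ONE CONFIGURATION U OVER THE DIRECTION LETTERS — the four entries of (3.42) for the sum G′(U) with ONE pair of
constants** (C = `const37 …`, δ = (1 − 2α)δ₀; the SAME constant and located smallness as v1 `B9Thm37Whole.conv342_of_local342`): entry 1 by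
`thm37_entry1_of_342` and entry 4 by `thm37_leftEntry_of_342` (E = Δ_U, W ≡ 1) AT the stacked direction letters (`Identities₂.eq388_stacked ∕ leibL_stacked ∕
hasMajorantHom_costackP∕PL`, `DirSupSq37.hasMajorantHom_stackDd`), entry 2 by §1 `thm37_leftEntry_of_342_twoD` (Leibniz at the slice letter `𝔬.D`), entry 3 by §2
`thm37_rightEntry_of_342_dir`; inputs: Corollary 3.6 for all G′_□(U) (`Local342`) with its per-direction entries (`DirSupSq37`), the structure of the expansion over
the direction letters (`Identities₂`), the static data (`StaticOK`), [4] Lemma 2.1 (2.61) at the exponent α, and «M sufficiently large» LOCATED exactly as in v1.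
[cite: Balaban1985BackgroundPropagators, Thm 3.7 (3.87)–(3.90) pp.408–410 + (3.42) p.397; Balaban1984PropagatorsII, Prop 2.2 (2.64)–(2.67) p.234] -/
theorem conv342_of_local342₂ [Fintype X] [DecidableEq X] [Fintype Y] [DecidableEq Y] [Fintype ι] [Fintype Dir]
    (𝔬 : Ops g B X Y ι) (𝔡 : DirOps37 𝔬 Dir) (𝔩 : DirLetters37 𝔬 Dir) (R : ℝ) (H : Prop) (d : ℕ) (δ₀ α ρ B₀ N N' Cℓ K : ℝ)
    (κ : Sizes) (U : B.Cfg)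
    (hB₀ : 0 ≤ B₀) (hδ₀ : 0 ≤ δ₀) (hα : 0 ≤ α) (hα2 : α ≤ 1 / 2) (hN : 0 ≤ N) (hN' : 0 ≤ N') (hCℓ : 1 ≤ Cℓ)
    (hK : 0 ≤ K) (hs : StaticOK 𝔬 ρ N N' Cℓ κ) (hκ : κ.Nonneg) (hKD : κ.kPD + κ.kCD ≤ K)
    (hKL : κ.kPL + κ.kCL ≤ K) (hKT : κ.kCLt ≤ K) (h261 : Ineq261 d (toB6 g R H) δ₀ α)
    (hq : N' * (B₀ * Real.exp (δ₀ * ρ) * (κ.kP + κ.kC)) * B6.c1 d δ₀ α ≤ 1 / 2)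
    (hq' : N' * (B₀ * Real.exp (δ₀ * ρ) * (κ.kPt + Cℓ * κ.kCt)) * B6.c1 d δ₀ α ≤ 1 / 2)
    (hl : Local342 𝔬 R H B₀ δ₀ U) (hT : DirSupSq37 𝔬 𝔡 R H U) (hi : Identities₂ 𝔬 𝔡 𝔩 R H U) :
    Conv342 𝔬 R H (const37 d δ₀ α ρ B₀ N N' Cℓ K) ((1 - 2 * α) * δ₀) U := by
  have hlen : ∀ y : g.Site, 0 ≤ g.len y := fun y => (hs.lenpos y).le
  have hαδ : 0 ≤ (1 - α) * δ₀ := mul_nonneg (by linarith) hδ₀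
  have hαδ' : 0 ≤ α * δ₀ := mul_nonneg hα hδ₀
  have hαδ2 : 0 ≤ (1 - 2 * α) * δ₀ := mul_nonneg (by linarith) hδ₀
  have htri : Triangle254 (toB6 g R H) := fun a b c => hs.tri a b c
  have h263 : Ineq263 d (toB6 g R H) δ₀ α := ineq263_of_261 d (toB6 g R H) δ₀ α htri hδ₀ (by linarith) h261
  have hk12 : 0 ≤ κ.kP + κ.kC := add_nonneg hκ.kP hκ.kC
  have hkD : 0 ≤ κ.kPD + κ.kCD := add_nonneg hκ.kPD hκ.kCD
  have hkL : 0 ≤ κ.kPL + κ.kCL := add_nonneg hκ.kPL hκ.kCL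
  have hCℓ0 : 0 ≤ Cℓ := le_trans zero_le_one hCℓ
  have hsmall : N' * (B₀ * Real.exp (δ₀ * ρ) * (κ.kP + κ.kC)) * B6.c1 d δ₀ α < 1 := by linarith
  have hsmall' : N' * (B₀ * Real.exp (δ₀ * ρ) * (κ.kPt + Cℓ * κ.kCt)) * B6.c1 d δ₀ α < 1 := by linarith
  have hc1 : 0 ≤ B6.c1 d δ₀ α := c1_nonneg d δ₀ α
  have hN'e : 0 ≤ N' * Real.exp (δ₀ * ρ) := mul_nonneg hN' (Real.exp_nonneg _)
  have hKCℓ : K ≤ Cℓ * K := by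
    calc K = 1 * K := (one_mul K).symm
      _ ≤ Cℓ * K := mul_le_mul_of_nonneg_right hCℓ hK
  -- the common target constant A′ and the comparison of the exponential rates
  have hexp : ∀ a b : g.Site, Real.exp (-((1 - α) * δ₀ * g.dist a b)) ≤ Real.exp (-((1 - 2 * α) * δ₀ * g.dist a b)) := by
    intro a b
    have h0 : 0 ≤ α * δ₀ * g.dist a b := mul_nonneg hαδ' (hs.dnn a b)
    exact Real.exp_le_exp.mpr (by nlinarith [h0])
  have hfin : ∀ w e' : ℝ, 2 * (B₀ * (N + N' * Real.exp (δ₀ * ρ) * (Cℓ * K)) * B6.c1 d δ₀ α) * w * e' =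
      const37 d δ₀ α ρ B₀ N N' Cℓ K * w * e' := by
    intro w e'
    simp only [const37]
    ring
  -- entry 1: G′ (`thm37_entry1_of_342`)
  -- the (3.88) inputs over the direction letters, read at the two-space letter `Y′ := X × Dir` (stacking device)
  have h2st : ∀ i, HasMajorantHom (g := toB6 g R H) 𝔬.blk (fun p : X × Dir => 𝔬.blk p.1)
      (stackDir (𝔡.Dd U) ∘ₗ 𝔬.Gsq U i) (fun a b => B₀ * g.len a * Real.exp (-(δ₀ * g.dist a b))) :=
    fun i => hT.hasMajorantHom_stackDd i _ (hl.e1 i)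
  have e1 := thm37_entry1_of_342 (R := R) (H := H) 𝔬.blk (fun p : X × Dir => 𝔬.blk p.1) d δ₀ α ρ B₀ κ.kP κ.kC N N' 𝔬.S 𝔬.S'
    𝔬.h 𝔬.KP 𝔬.KC
    hB₀ hδ₀ hk12 hN hN' hαδ htri hs.refl hs.dnn hlen h261 h263 hsmall hs.hh hs.hS hs.cnt hs.cnt'
    hs.KP_nonneg hs.KP_loc hs.KP_row hs.KC_nonneg hs.KC_loc hs.KC_row hl.e0 h2st hi.hasMajorantHom_costackP hi.hC hi.inv
    hi.eq388_stacked
  -- entry 2: ∇_UG′ (the two-derivative left face: (3.88) at the stacked direction letters, Leibniz at the slice letter `𝔬.D`)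
  have e2 := thm37_leftEntry_of_342_twoD (R := R) (H := H) 𝔬.blk (fun p : X × Dir => 𝔬.blk p.1) 𝔬.blkY 𝔬.blkY d δ₀ α ρ B₀
    κ.kP κ.kC κ.kPD κ.kCD N N' (fun y => g.len y) 𝔬.S 𝔬.S' 𝔬.h 𝔬.hY 𝔬.KP 𝔬.KC 𝔬.KPD 𝔬.KCD
    hB₀ hδ₀ hk12 hkD hN hN' hlen hαδ htri hs.refl hs.dnn hlen h261 h263 hsmall hs.hh hs.hhY hs.hSY hs.cnt hs.cnt'
    hs.KP_nonneg hs.KP_loc hs.KP_row hs.KC_nonneg hs.KC_loc hs.KC_row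
    hs.KPD_nonneg hs.KPD_loc hs.KPD_row hs.KCD_nonneg hs.KCD_loc hs.KCD_row
    hl.e0 h2st hl.e1 hl.e1 hi.hasMajorantHom_costackP hi.hC hi.hPD hi.hCD hi.leibD hi.inv hi.eq388_stacked
  -- entry 3: G′∇*_U (the right face with the transposed (3.88) summed over the directions)
  have e3 := thm37_rightEntry_of_342_dir (R := R) (H := H) 𝔬.blk 𝔬.blkY d δ₀ α ρ B₀ κ.kPt κ.kCt κ.kCLt Cℓ N N'
    𝔬.S 𝔬.S' 𝔬.h 𝔬.hY 𝔬.KPt 𝔬.KCt 𝔬.KCLt 𝔩.KPtd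
    hB₀ hδ₀ hκ.kPt hκ.kCt hκ.kCLt hCℓ0 hN hN' hαδ' hαδ2 htri hs.refl hs.symm hs.dnn hs.lenpos h261 h263 hsmall'
    hs.hh hs.hS hs.hhY hs.cnt hs.cnt' hs.comp
    hs.KPt_loc hs.KPt_col hi.KPtd_nonneg hi.KPtd_sum hs.KCt_nonneg hs.KCt_loc hs.KCt_col hs.KCLt_nonneg hs.KCLt_loc
    hs.KCLt_col hl.e0 hl.e2 (fun i μ => hT.right i _ (hl.e2 i) μ) hi.hPt hi.hCt hi.hCLt hi.leibT hi.inv hi.eq388T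
  -- entry 4: Δ_UG′ (v1's left face AT the stacked direction letters: (3.88) and the Leibniz rule of Δ_U share `stackDir ∇_{U,·}`)
  have e4 := thm37_leftEntry_of_342 (R := R) (H := H) 𝔬.blk (fun p : X × Dir => 𝔬.blk p.1) 𝔬.blk d δ₀ α ρ B₀ κ.kP κ.kC κ.kPL
    κ.kCL N N' (fun _ => (1 : ℝ)) 𝔬.S 𝔬.S' 𝔬.h 𝔬.h 𝔬.KP 𝔬.KC 𝔬.KPL 𝔬.KCL
    hB₀ hδ₀ hk12 hkL hN hN' (fun _ => zero_le_one) hαδ htri hs.refl hs.dnn hlen h261 h263 hsmall hs.hh hs.hh hs.hS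
    hs.cnt hs.cnt'
    hs.KP_nonneg hs.KP_loc hs.KP_row hs.KC_nonneg hs.KC_loc hs.KC_row
    hs.KPL_nonneg hs.KPL_loc (fun i a => by simpa only [mul_one] using hs.KPL_row i a)
    hs.KCL_nonneg hs.KCL_loc (fun i a => by simpa only [mul_one] using hs.KCL_row i a)
    hl.e0 h2st
    (fun i => hasMajorantHom_mono (g := toB6 g R H) 𝔬.blk 𝔬.blk (hl.e3 i) fun a b => by simp only [mul_one, le_refl])
    hi.hasMajorantHom_costackP hi.hC hi.hasMajorantHom_costackPL hi.hCL hi.leibL_stacked hi.inv hi.eq388_stacked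
  -- the comparisons of the four constants with A′ = B₀(N + N′e^{δ₀ρ}(C_ℓK))c₁
  have hA1 : 0 ≤ N * B₀ * B6.c1 d δ₀ α := mul_nonneg (mul_nonneg hN hB₀) hc1
  have hA1' : N * B₀ * B6.c1 d δ₀ α ≤ B₀ * (N + N' * Real.exp (δ₀ * ρ) * (Cℓ * K)) * B6.c1 d δ₀ α := by
    have h1 : N ≤ N + N' * Real.exp (δ₀ * ρ) * (Cℓ * K) :=
      le_add_of_nonneg_right (mul_nonneg hN'e (mul_nonneg hCℓ0 hK))
    calc N * B₀ * B6.c1 d δ₀ α = N * (B₀ * B6.c1 d δ₀ α) := by ring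
      _ ≤ (N + N' * Real.exp (δ₀ * ρ) * (Cℓ * K)) * (B₀ * B6.c1 d δ₀ α) :=
          mul_le_mul_of_nonneg_right h1 (mul_nonneg hB₀ hc1)
      _ = B₀ * (N + N' * Real.exp (δ₀ * ρ) * (Cℓ * K)) * B6.c1 d δ₀ α := by ring
  have hA2 : 0 ≤ B₀ * (N + N' * Real.exp (δ₀ * ρ) * (κ.kPD + κ.kCD)) * B6.c1 d δ₀ α :=
    mul_nonneg (mul_nonneg hB₀ (add_nonneg hN (mul_nonneg hN'e hkD))) hc1
  have hA2' : B₀ * (N + N' * Real.exp (δ₀ * ρ) * (κ.kPD + κ.kCD)) * B6.c1 d δ₀ α ≤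
      B₀ * (N + N' * Real.exp (δ₀ * ρ) * (Cℓ * K)) * B6.c1 d δ₀ α :=
    constA_le hB₀ hN'e hc1 (hKD.trans hKCℓ)
  have hA4 : 0 ≤ B₀ * (N + N' * Real.exp (δ₀ * ρ) * (κ.kPL + κ.kCL)) * B6.c1 d δ₀ α :=
    mul_nonneg (mul_nonneg hB₀ (add_nonneg hN (mul_nonneg hN'e hkL))) hc1
  have hA4' : B₀ * (N + N' * Real.exp (δ₀ * ρ) * (κ.kPL + κ.kCL)) * B6.c1 d δ₀ α ≤
      B₀ * (N + N' * Real.exp (δ₀ * ρ) * (Cℓ * K)) * B6.c1 d δ₀ α :=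
    constA_le hB₀ hN'e hc1 (hKL.trans hKCℓ)
  have hA3 : 0 ≤ B₀ * (N + N' * Real.exp (δ₀ * ρ) * Cℓ * κ.kCLt) * B6.c1 d δ₀ α :=
    mul_nonneg (mul_nonneg hB₀ (add_nonneg hN (mul_nonneg (mul_nonneg hN'e hCℓ0) hκ.kCLt))) hc1
  have hA3' : B₀ * (N + N' * Real.exp (δ₀ * ρ) * Cℓ * κ.kCLt) * B6.c1 d δ₀ α ≤
      B₀ * (N + N' * Real.exp (δ₀ * ρ) * (Cℓ * K)) * B6.c1 d δ₀ α := by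
    have h := constA_le (N := N) hB₀ hN'e hc1 (mul_le_mul_of_nonneg_left hKT hCℓ0)
    calc B₀ * (N + N' * Real.exp (δ₀ * ρ) * Cℓ * κ.kCLt) * B6.c1 d δ₀ α
        = B₀ * (N + N' * Real.exp (δ₀ * ρ) * (Cℓ * κ.kCLt)) * B6.c1 d δ₀ α := by ring
      _ ≤ B₀ * (N + N' * Real.exp (δ₀ * ρ) * (Cℓ * K)) * B6.c1 d δ₀ α := h
  refine ⟨?_, ?_, ?_, ?_⟩
  · refine hasMajorant_mono (g := toB6 g R H) 𝔬.blk e1 fun a b => ?_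
    calc N * B₀ * B6.c1 d δ₀ α * (1 - N' * (B₀ * Real.exp (δ₀ * ρ) * (κ.kP + κ.kC)) * B6.c1 d δ₀ α)⁻¹ *
          g.len a ^ 2 * Real.exp (-((1 - α) * δ₀ * g.dist a b))
        ≤ 2 * (B₀ * (N + N' * Real.exp (δ₀ * ρ) * (Cℓ * K)) * B6.c1 d δ₀ α) * g.len a ^ 2 *
            Real.exp (-((1 - 2 * α) * δ₀ * g.dist a b)) :=
          weaken hA1 hA1' hq (sq_nonneg _) (Real.exp_nonneg _) (hexp a b)
      _ = _ := hfin _ _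
  · refine hasMajorantHom_mono (g := toB6 g R H) 𝔬.blk 𝔬.blkY e2 fun a b => ?_
    calc B₀ * (N + N' * Real.exp (δ₀ * ρ) * (κ.kPD + κ.kCD)) * B6.c1 d δ₀ α *
          (1 - N' * (B₀ * Real.exp (δ₀ * ρ) * (κ.kP + κ.kC)) * B6.c1 d δ₀ α)⁻¹ * g.len a *
          Real.exp (-((1 - α) * δ₀ * g.dist a b))
        ≤ 2 * (B₀ * (N + N' * Real.exp (δ₀ * ρ) * (Cℓ * K)) * B6.c1 d δ₀ α) * g.len a *
            Real.exp (-((1 - 2 * α) * δ₀ * g.dist a b)) :=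
          weaken hA2 hA2' hq (hlen a) (Real.exp_nonneg _) (hexp a b)
      _ = _ := hfin _ _
  · refine hasMajorantHom_mono (g := toB6 g R H) 𝔬.blkY 𝔬.blk e3 fun a b => ?_
    calc B₀ * (N + N' * Real.exp (δ₀ * ρ) * Cℓ * κ.kCLt) * B6.c1 d δ₀ α *
          (1 - N' * (B₀ * Real.exp (δ₀ * ρ) * (κ.kPt + Cℓ * κ.kCt)) * B6.c1 d δ₀ α)⁻¹ * g.len a *
          Real.exp (-((1 - 2 * α) * δ₀ * g.dist a b))
        ≤ 2 * (B₀ * (N + N' * Real.exp (δ₀ * ρ) * (Cℓ * K)) * B6.c1 d δ₀ α) * g.len a *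
            Real.exp (-((1 - 2 * α) * δ₀ * g.dist a b)) :=
          weaken hA3 hA3' hq' (hlen a) (Real.exp_nonneg _) le_rfl
      _ = _ := hfin _ _
  · refine hasMajorantHom_mono (g := toB6 g R H) 𝔬.blk 𝔬.blk e4 fun a b => ?_
    calc B₀ * (N + N' * Real.exp (δ₀ * ρ) * (κ.kPL + κ.kCL)) * B6.c1 d δ₀ α *
          (1 - N' * (B₀ * Real.exp (δ₀ * ρ) * (κ.kP + κ.kC)) * B6.c1 d δ₀ α)⁻¹ * (fun _ => (1 : ℝ)) a *
          Real.exp (-((1 - α) * δ₀ * g.dist a b))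
        ≤ 2 * (B₀ * (N + N' * Real.exp (δ₀ * ρ) * (Cℓ * K)) * B6.c1 d δ₀ α) * (fun _ => (1 : ℝ)) a *
            Real.exp (-((1 - 2 * α) * δ₀ * g.dist a b)) :=
          weaken hA4 hA4' hq zero_le_one (Real.exp_nonneg _) (hexp a b)
      _ = const37 d δ₀ α ρ B₀ N N' Cℓ K * Real.exp (-((1 - 2 * α) * δ₀ * g.dist a b)) := by
          simp only [const37]
          ring


end Whole

section Family

variable {I : Type} {c35 : ℝ} {geo : I → B9.Geometry} {bg : I → B9.Backgrounds}
variable [∀ i, Fintype (geo i).Site] [∀ i, DecidableEq (geo i).Site]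
variable {X Y ι Dir : I → Type} [∀ i, Fintype (X i)] [∀ i, DecidableEq (X i)] [∀ i, Fintype (Y i)]
  [∀ i, DecidableEq (Y i)] [∀ i, Fintype (ι i)] [∀ i, Fintype (Dir i)]

/-- ★★ **THEOREM 3.7 AS THE WHOLE PRINTED LEAF `B9.Thm37Printed` OVER THE DIRECTION LETTERS**, INHABITED at the expansion data `E37OfOps (𝔴 i) (𝔬 i) (R i) (H i) C δ`
with the SAME explicit constants as v1 (C = `const37 d δ₀ α ρ B₀ N N' Cℓ K`, δ = (1 − 2α)δ₀) — from, per member and per U under the printed provisos of Corollary 3.6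
(M ≧ M₁, 0 < α₀, O(1)Mα₀ ≦ a₁, U satisfying (3.35)): Corollary 3.6 for all G′_□(U) (`Local342`), its per-direction entries (`DirSupSq37`) and the structure of the
expansion over the direction letters (`Identities₂`); per member: `StaticOK`, `Sizes.Bounded`, [4] Lemma 2.1 (2.61) at the exponent α for M ≧ M_L.  Thresholds as v1:
M₂ := max(M₁, M_L, 2N′B₀e^{δ₀ρ}θ₀c₁(α)), a₀ := a₁ ∕ c35.  Nothing of print asserted; NOT a node discharge.
[cite: Balaban1985BackgroundPropagators, Thm 3.7 (3.90) pp.409–410 + Cor. 3.6 p.408 + (3.35) p.396; Balaban1984PropagatorsII, Lemma 2.1 (2.61) p.234 + Prop 2.2 p.234] -/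
theorem thm37Printed_of_local342₂ (𝔴 : ∀ i, B9.RWExpansion (geo i) (bg i))
    (𝔬 : ∀ i, Ops (geo i) (bg i) (X i) (Y i) (ι i)) (𝔡 : ∀ i, DirOps37 (𝔬 i) (Dir i)) (𝔩 : ∀ i, DirLetters37 (𝔬 i) (Dir i))
    (R : I → ℝ) (H : I → Prop) (κ : I → Sizes) (d : ℕ)
    (α ρ N N' Cℓ K θ₀ B₀ δ₀ a₁ M₁ ML : ℝ)
    (hc : 0 < c35) (hα : 0 ≤ α) (hα2 : α ≤ 1 / 2) (hN : 0 ≤ N) (hN' : 0 ≤ N') (hCℓ : 1 ≤ Cℓ) (hK : 0 ≤ K)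
    (hB₀ : 0 ≤ B₀) (hδ₀ : 0 ≤ δ₀) (ha₁ : 0 < a₁) (hM₁ : 0 < M₁)
    (hst : ∀ i, StaticOK (𝔬 i) ρ N N' Cℓ (κ i)) (hκ : ∀ i, (κ i).Bounded K θ₀ Cℓ (geo i).M)
    (h261 : ∀ i, ML ≤ (geo i).M → Ineq261 d (toB6 (geo i) (R i) (H i)) δ₀ α)
    (h36 : ∀ i, M₁ ≤ (geo i).M → ∀ α₀ : ℝ, 0 < α₀ → c35 * (geo i).M * α₀ ≤ a₁ →
      ∀ U : (bg i).Cfg, (bg i).Reg335 c35 α₀ U →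
        Local342 (𝔬 i) (R i) (H i) B₀ δ₀ U ∧ DirSupSq37 (𝔬 i) (𝔡 i) (R i) (H i) U ∧ Identities₂ (𝔬 i) (𝔡 i) (𝔩 i) (R i) (H i) U) :
    B9.Thm37Printed c35 geo bg
      (fun i => E37OfOps (𝔴 i) (𝔬 i) (R i) (H i) (const37 d δ₀ α ρ B₀ N N' Cℓ K) ((1 - 2 * α) * δ₀)) := by
  refine ⟨max M₁ (max ML (2 * N' * (B₀ * Real.exp (δ₀ * ρ) * θ₀) * B6.c1 d δ₀ α)), a₁ / c35,
    lt_max_of_lt_left hM₁, div_pos ha₁ hc, ?_⟩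
  intro i hM α₀ hα₀ hMa U hU
  have hM₁i : M₁ ≤ (geo i).M := le_trans (le_max_left _ _) hM
  have hMLi : ML ≤ (geo i).M := le_trans (le_trans (le_max_left _ _) (le_max_right _ _)) hM
  have hbig : 2 * N' * (B₀ * Real.exp (δ₀ * ρ) * θ₀) * B6.c1 d δ₀ α ≤ (geo i).M :=
    le_trans (le_trans (le_max_right _ _) (le_max_right _ _)) hM
  have hMpos : 0 < (geo i).M := lt_of_lt_of_le hM₁ hM₁i
  have ha : c35 * (geo i).M * α₀ ≤ a₁ := by
    have h1 : (geo i).M * α₀ * c35 ≤ a₁ := (le_div_iff₀ hc).mp hMa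
    calc c35 * (geo i).M * α₀ = (geo i).M * α₀ * c35 := by ring
      _ ≤ a₁ := h1
  obtain ⟨hl, hT, hi⟩ := h36 i hM₁i α₀ hα₀ ha U hU
  have hBe : 0 ≤ B₀ * Real.exp (δ₀ * ρ) := mul_nonneg hB₀ (Real.exp_nonneg _)
  have hc1 : 0 ≤ B6.c1 d δ₀ α := c1_nonneg d δ₀ α
  have hq : N' * (B₀ * Real.exp (δ₀ * ρ) * ((κ i).kP + (κ i).kC)) * B6.c1 d δ₀ α ≤ 1 / 2 :=
    small_of_size hN' hBe hc1 hMpos (hκ i).row hbig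
  have hq' : N' * (B₀ * Real.exp (δ₀ * ρ) * ((κ i).kPt + Cℓ * (κ i).kCt)) * B6.c1 d δ₀ α ≤ 1 / 2 :=
    small_of_size hN' hBe hc1 hMpos (hκ i).col hbig
  exact conv342_of_local342₂ (𝔬 i) (𝔡 i) (𝔩 i) (R i) (H i) d δ₀ α ρ B₀ N N' Cℓ K (κ i) U hB₀ hδ₀ hα hα2 hN hN' hCℓ hK (hst i)
    (hκ i).nonneg (hκ i).leibD (hκ i).leibL (hκ i).leibT (h261 i hMLi) hq hq' hl hT hi


end Family

end

end Literature.MathematicalPhysics.QuantumFieldTheory.Balaban1983to89.B9Thm37GlueDir
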